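import Literature.MathematicalPhysics.QuantumFieldTheory.Balaban1983to89.B6DeltaPrime2109Torus

/-!
# `Balaban1983to89.B6Eq2110Gamma0Witness` — T. Bałaban, *Propagators and renormalization transformations for lattice gauge
# theories. II*, Commun. Math. Phys. **96** (1984) 223–250 [Balaban1984PropagatorsII], p.242 before (2.110): the aside
# *«(we can take γ₀ = π²/L² in fact)»* in *«we have ‖Δ₀ω‖² ≥ γ₀‖ω‖² with γ₀ > 0»* is FALSE AS PRINTED for every L ≥ 13
# (kernel witness on the torus: a pure frequency 2π/L in one direction); the best constant is of order L⁻⁴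

statement-level skeleton of published theorems with citation tags; proofs where landed; nothing here is a claim about the Yang–Mills mass gap

PDF held: `paper:balaban1984-cmp96-propagators-rt-ii` (journal page = PDF page + 222); p. 242 [PDF 20] read.

CITATION HEADER (lean-in-tree rule).  WHAT IS REPRODUCED: lit-balaban SKELETON row **B6.Eq2.110** ((2.110) p. 242),
the sentence, verbatim: *"Now let us consider the integral with respect to ω. We integrate over the functions satisfying
the restriction Q′₁ω = 0, and then we have ‖Δ₀ω‖² ≥ γ₀‖ω‖² with γ₀ > 0 (we can take γ₀ = π²/L² in fact). Hence
γ₀‖ω‖² ≤ ⟨ω, Δ′_jω⟩ ≤ γ₁‖ω‖² for ω : Q′₁ω = 0, (2.110) with positive constants γ₀, γ₁ dependent on d and L only."*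
Here `Δ₀` = the unit-lattice Laplace operator of (2.108)/(2.109) (`B5Action121.LapS _ 1`; the reading of the whole
lineage `…B6Hprime2101` → `…B6DeltaPrime2109Torus`, under which (2.109) holds with d-only c₀, c₁ — `bound_2109`,
`ineq2109`), `Q′₁` = the averaging over the L-blocks (`B5Block118.QsOp L M`).  STATE OF THE TREE: the display (2.110) is
PROVED for the typed torus `Δ′_j` with γ₀ = c₀(d)·(8/L²)², γ₁ = γ₁(d) (`…B6DeltaPrime2110Torus.ineq2110`, r03 g6
p255982), i.e. the sentence *"with positive constants γ₀, γ₁ dependent on d and L only"* holds; that file declared the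
parenthetical constant NOT claimed.  THIS FILE decides the parenthetical: **`poincare_pi_sq_fails`** — for every L ≥ 13, every
d ≥ 1 and every torus `T = Π_μ ℤ/(L·M_μ)` there is `ω ≠ 0` with `Q′₁ω = 0` and `‖Δ₀ω‖² < (π²/L²)‖ω‖²`; the witness is the
character `ω(x) = e^{ip·x}` of the dual momentum `p = (2π/L, 0, …, 0)` (`omega0`): its L-block averages vanish
(`QsOp_omega0`, via (1.30) `B5Block118.dft_QsOp` and «u_k(l) = 0 for l ≠ 0» `uSym_sOf_zero`), and `Δ₀ω = (2 − 2cos(2π/L))ω`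
so that `‖Δ₀ω‖² = (2 − 2cos(2π/L))²‖ω‖² ≤ (2π/L)⁴‖ω‖² < (π²/L²)‖ω‖²` as soon as `L² > 16π²` (`normSq_LapS_omega0`,
`witness_ratio_lt`).  Consequently (`gamma0_le_of_poincare`) ANY γ₀ with `‖Δ₀ω‖² ≥ γ₀‖ω‖²` on `Q′₁ω = 0` satisfies
`γ₀ ≤ (2 − 2cos(2π/L))² ≤ 16π⁴/L⁴`: the true constant is of order L⁻⁴ (the order certified in `…B6DeltaPrime2110Torus`,
`(8/L²)²`), not L⁻².  Unit `lit-balaban-r03` (B6 reader/owner, gen 6), PHASE 2, HOME `run/shared/lean/pub/lit-balaban/`,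
2026-08-21.  IMPORTS `…B6DeltaPrime2109Torus` (Plancherel forms `norm_sq_eq`/`norm_LapS_sq`, `lsym_one_eq`) BY NAME;
one definition with body (`omega0`, the witness), no new named fact, 0 sorry.

## Honest scope

(i) What is refuted is ONLY the parenthetical value γ₀ = π²/L² (for L ≥ 13; for small L it may hold); the display (2.110)
and the sentence *"γ₀, γ₁ dependent on d and L only"* are TRUE and proved (`ineq2110`), and nothing downstream uses the
value π²/L² (GAPS row filed with this proposal; consumers need γ₀ > 0 depending on d, L only).  (ii) Torus model, complex
ω, `Δ₀ = LapS _ 1` as in the lineage.  (iii) Value = kernel certificate locating a printed aside of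
[Balaban1984PropagatorsII]; NOT summit progress, NOT continuum, NOT Clay.
-/

open scoped BigOperators Matrix ComplexConjugate Real
open Finset Complex

namespace Literature.MathematicalPhysics.QuantumFieldTheory.Balaban1983to89.B6Eq2110Gamma0Witness

open Literature.MathematicalPhysics.QuantumFieldTheory.Balaban1983to89.B4Strip (S1r Delta1r)
open Literature.MathematicalPhysics.QuantumFieldTheory.Balaban1983to89.B5Prop11Plancherel (Tor chi dft fine sOf sOf_zero)
open Literature.MathematicalPhysics.QuantumFieldTheory.Balaban1983to89.B5Prop11Fiber (uSym)
open Literature.MathematicalPhysics.QuantumFieldTheory.Balaban1983to89.B5Action121 (LapS)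
open Literature.MathematicalPhysics.QuantumFieldTheory.Balaban1983to89.B5Block118 (cT dft_apply' sum_conj_chi_mul_chi pOf
  pOf_injective QsOp dft_QsOp cQ uSym_sOf_zero)
open Literature.MathematicalPhysics.QuantumFieldTheory.Balaban1983to89.B5Hk163Torus (dft_mulVec_injective)
open Literature.MathematicalPhysics.QuantumFieldTheory.Balaban1983to89.B6DeltaPrime2109Torus (norm_sq_eq norm_LapS_sq)

noncomputable section

variable {d : ℕ} (k : ℕ) (M : Fin (d + 1) → ℕ) [hM : ∀ μ, NeZero (M μ)]

/-! ## §1. The witness: the character of the dual momentum `(2π/L, 0, …, 0)` -/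

/-- the fine-offset index `l = (1, 0, …, 0)` (needs `L = k + 1 ≥ 2`). [cite: Balaban1984PropagatorsII, (2.110) p.242 (locating the aside «γ₀ = π²/L²»)] [folklore] -/
def k0 (hk : 1 ≤ k) : Fin (d + 1) → Fin (k + 1) := fun i => if i = 0 then ⟨1, by omega⟩ else 0

/-- the witness momentum `p₀ = p′ + l` with `p′ = 0`, `l = (1, 0, …, 0)`: `p₀ = (2π/L, 0, …, 0)` on `T = Π_μ ℤ/(L·M_μ)`.
[cite: Balaban1984PropagatorsI, (1.29)–(1.31) p.23 (momenta p = p′ + l; dictionary)] [folklore] -/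
def q0 (hk : 1 ≤ k) : Tor (fine (k + 1) M) := pOf (k + 1) M (k0 k hk, 0)

/-- **THE WITNESS** `ω₀(x) = e^{ip₀·x}`, a pure frequency `2π/L` in the first direction. [cite: Balaban1984PropagatorsII, (2.110) p.242 (locating the aside «γ₀ = π²/L²»)] [folklore] -/
def omega0 (hk : 1 ≤ k) : Tor (fine (k + 1) M) → ℂ := fun x => chi (fine (k + 1) M) (q0 k M hk) x

omit hM in
/-- `l ≠ 0`. [cite: Balaban1984PropagatorsII, (2.110) p.242 (locating the aside «γ₀ = π²/L²»)] [folklore] -/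
theorem k0_ne_zero (hk : 1 ≤ k) : k0 (d := d) k hk ≠ 0 := by
  intro h
  have h0 := congrFun h 0
  simp only [k0, ↓reduceIte, Pi.zero_apply, Fin.ext_iff, Fin.val_zero] at h0
  exact one_ne_zero h0

/-- the momentum representation of the witness: `ω̂₀ = c_T|T|·δ_{p₀}`. [cite: Balaban1984PropagatorsII, (2.110) p.242 (locating the aside «γ₀ = π²/L²»)] [folklore] -/
theorem dft_omega0 (hk : 1 ≤ k) (p : Tor (fine (k + 1) M)) :
    (dft (fine (k + 1) M) *ᵥ omega0 k M hk) p
      = if p = q0 k M hk then (cT (fine (k + 1) M) : ℂ) * (Fintype.card (Tor (fine (k + 1) M)) : ℂ) else 0 := by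
  simp only [Matrix.mulVec, dotProduct, omega0, dft_apply']
  simp_rw [mul_assoc]
  rw [← Finset.mul_sum, sum_conj_chi_mul_chi]
  by_cases h : p = q0 k M hk
  · rw [if_pos h, if_pos h.symm]
  · rw [if_neg h, if_neg (Ne.symm h), mul_zero]

/-- **`Q′₁ω₀ = 0`**: the L-block averages of the witness vanish — in momentum space (1.30) `(Q′₁ω)^(p′) = c·Σ_l u(p′+l)ω̂(p′+l)`
and `ω̂₀` lives at `p′ = 0`, `l ≠ 0`, where `u(l) = 0` («u_k(l) = 0 for l ≠ 0»).
[cite: Balaban1984PropagatorsI, (1.30)–(1.31) p.23] [folklore] -/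
theorem QsOp_omega0 (hk : 1 ≤ k) : QsOp (k + 1) M *ᵥ omega0 k M hk = 0 := by
  have h : dft M *ᵥ (QsOp (k + 1) M *ᵥ omega0 k M hk) = dft M *ᵥ (0 : Tor M → ℂ) := by
    rw [Matrix.mulVec_zero]
    funext q
    rw [dft_QsOp, Pi.zero_apply]
    have hsum : ∑ l : Fin (d + 1) → Fin (k + 1),
        uSym (k + 1) l (sOf M q) * (dft (fine (k + 1) M) *ᵥ omega0 k M hk) (pOf (k + 1) M (l, q)) = 0 := by
      refine Finset.sum_eq_zero fun l _ => ?_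
      rw [dft_omega0]
      by_cases hl : pOf (k + 1) M (l, q) = q0 k M hk
      · have hlq : (l, q) = (k0 k hk, 0) := pOf_injective (k + 1) M (by rw [hl]; rfl)
        have hl0 : l = k0 k hk := (Prod.mk.inj hlq).1
        have hq0 : q = 0 := (Prod.mk.inj hlq).2
        rw [hq0, hl0, uSym_sOf_zero, if_neg (k0_ne_zero k hk), zero_mul]
      · rw [if_neg hl, mul_zero]
    rw [hsum, mul_zero]
  exact dft_mulVec_injective M h

/-- `‖ω₀‖² = |T| > 0`; in particular `ω₀ ≠ 0`. [cite: Balaban1984PropagatorsII, (2.110) p.242 (locating the aside «γ₀ = π²/L²»)] [folklore] -/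
theorem normSq_omega0 (hk : 1 ≤ k) :
    (star (omega0 k M hk) ⬝ᵥ omega0 k M hk) = (Fintype.card (Tor (fine (k + 1) M)) : ℂ) := by
  simp only [dotProduct, Pi.star_apply, Complex.star_def, omega0]
  rw [sum_conj_chi_mul_chi, if_pos rfl]

/-- `ω₀ ≠ 0`. [cite: Balaban1984PropagatorsII, (2.110) p.242 (locating the aside «γ₀ = π²/L²»)] [folklore] -/
theorem omega0_ne_zero (hk : 1 ≤ k) : omega0 k M hk ≠ 0 := by
  intro h
  have h1 := normSq_omega0 k M hk
  rw [h, dotProduct_zero] at h1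
  have h2 : (0 : ℂ).re = ((Fintype.card (Tor (fine (k + 1) M)) : ℂ)).re := congrArg Complex.re h1
  rw [Complex.zero_re, Complex.natCast_re] at h2
  have h3 : 0 < Fintype.card (Tor (fine (k + 1) M)) := Fintype.card_pos
  exact absurd h2.symm (by exact_mod_cast h3.ne')

/-! ## §2. `Δ₀ω₀ = (2 − 2cos(2π/L))·ω₀`: the symbol at the witness momentum -/

omit hM in
/-- first component of the witness momentum: `M₀` steps of `2π/(L·M₀)`, i.e. `2π/L`. [cite: Balaban1984PropagatorsII, (2.110) p.242 (locating the aside «γ₀ = π²/L²»)] [folklore] -/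
theorem q0_apply_zero (hk : 1 ≤ k) : q0 k M hk 0 = ((M 0 : ℕ) : ZMod (fine (k + 1) M 0)) := by
  simp [q0, pOf, k0]

omit hM in
/-- the other components of the witness momentum vanish. [cite: Balaban1984PropagatorsII, (2.110) p.242 (locating the aside «γ₀ = π²/L²»)] [folklore] -/
theorem q0_apply_ne (hk : 1 ≤ k) {μ : Fin (d + 1)} (hμ : μ ≠ 0) : q0 k M hk μ = 0 := by
  simp [q0, pOf, k0, hμ]

/-- the dual momentum of the witness: `p₀ = (2π/L, 0, …, 0)`. [cite: Balaban1984PropagatorsI, (1.29) p.23] [folklore] -/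
theorem sOf_q0 (hk : 1 ≤ k) (μ : Fin (d + 1)) :
    sOf (fine (k + 1) M) (q0 k M hk) μ = if μ = 0 then 2 * Real.pi / ((k : ℝ) + 1) else 0 := by
  unfold sOf
  by_cases hμ : μ = 0
  · subst hμ
    have hle : M 0 ≤ fine (k + 1) M 0 / 2 := by
      show M 0 ≤ (k + 1) * M 0 / 2
      rw [Nat.le_div_iff_mul_le (by norm_num)]
      nlinarith
    rw [if_pos rfl, q0_apply_zero, ZMod.valMinAbs_natCast_of_le_half hle]
    have hM0 : (0 : ℝ) < M 0 := by exact_mod_cast Nat.pos_of_ne_zero (NeZero.ne (M 0))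
    rw [show ((fine (k + 1) M 0 : ℕ) : ℝ) = ((k : ℝ) + 1) * (M 0 : ℝ) by
      show ((((k + 1) * M 0 : ℕ)) : ℝ) = _; push_cast; ring]
    push_cast
    field_simp
  · rw [if_neg hμ, q0_apply_ne k M hk hμ, ZMod.valMinAbs_zero]
    simp

omit hM in
/-- the unit Laplace symbol at `p₀`: `Δ₀(p₀) = 2 − 2cos(2π/L)`. [cite: Balaban1984PropagatorsII, (2.108)–(2.109) p.242 (Δ₀)] [folklore] -/
theorem Delta1r_q0 (hk : 1 ≤ k) [∀ μ, NeZero (M μ)] :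
    Delta1r 0 (sOf (fine (k + 1) M) (q0 k M hk)) = 2 - 2 * Real.cos (2 * Real.pi / ((k : ℝ) + 1)) := by
  unfold Delta1r
  rw [add_zero, Finset.sum_eq_single (0 : Fin (d + 1))]
  · rw [sOf_q0, if_pos rfl, S1r]
  · intro μ _ hμ
    rw [sOf_q0, if_neg hμ, S1r, Real.cos_zero]; ring
  · intro h; exact absurd (Finset.mem_univ _) h

/-- **`‖Δ₀ω₀‖² = (2 − 2cos(2π/L))²·‖ω₀‖²** (Plancherel: both sides live at the single momentum `p₀`).
[cite: Balaban1984PropagatorsII, p.242 «‖Δ₀ω‖² ≥ γ₀‖ω‖²»] [folklore] -/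
theorem normSq_LapS_omega0 (hk : 1 ≤ k) :
    (star (LapS (fine (k + 1) M) 1 *ᵥ omega0 k M hk) ⬝ᵥ (LapS (fine (k + 1) M) 1 *ᵥ omega0 k M hk)).re
      = (2 - 2 * Real.cos (2 * Real.pi / ((k : ℝ) + 1))) ^ 2 * (star (omega0 k M hk) ⬝ᵥ omega0 k M hk).re := by
  rw [norm_LapS_sq, norm_sq_eq, Complex.ofReal_re, Complex.ofReal_re, Finset.mul_sum]
  refine Finset.sum_congr rfl fun p _ => ?_
  rw [dft_omega0]
  by_cases h : p = q0 k M hk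
  · rw [if_pos h, h, Delta1r_q0]
  · rw [if_neg h, norm_zero]; ring

/-! ## §3. Numerics and the refutation -/

omit hM in
/-- `(2 − 2cos(2π/L))² ≤ (2π/L)⁴ < π²/L²` for `L ≥ 13` (`1 − x²/2 ≤ cos x`, `π < 3.15`, `16π² < 169 ≤ L²`). [cite: Balaban1984PropagatorsII, (2.110) p.242 (locating the aside «γ₀ = π²/L²»)] [folklore] -/
theorem witness_ratio_lt (hk : 12 ≤ k) :
    (2 - 2 * Real.cos (2 * Real.pi / ((k : ℝ) + 1))) ^ 2 < Real.pi ^ 2 / ((k : ℝ) + 1) ^ 2 := by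
  set L : ℝ := (k : ℝ) + 1 with hL
  have hL13 : (13 : ℝ) ≤ L := by
    rw [hL]; have : (12 : ℝ) ≤ (k : ℝ) := by exact_mod_cast hk
    linarith
  have hLpos : 0 < L := by linarith
  set θ : ℝ := 2 * Real.pi / L with hθ
  have hθpos : 0 ≤ θ := by rw [hθ]; positivity
  have hcos := Real.one_sub_sq_div_two_le_cos (x := θ)
  have h1 : 2 - 2 * Real.cos θ ≤ θ ^ 2 := by linarith
  have h0 : 0 ≤ 2 - 2 * Real.cos θ := by linarith [Real.cos_le_one θ]
  have h2 : (2 - 2 * Real.cos θ) ^ 2 ≤ (θ ^ 2) ^ 2 := pow_le_pow_left₀ h0 h1 2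
  have hπ := Real.pi_lt_d2
  have hπ0 := Real.pi_pos
  -- (θ²)² = 16π⁴/L⁴ < π²/L² ⟺ 16π² < L²
  have hπ2 : Real.pi ^ 2 < 3.15 ^ 2 := by nlinarith
  have hL2 : (13 : ℝ) ^ 2 ≤ L ^ 2 := pow_le_pow_left₀ (by norm_num) hL13 2
  have hnum : (16 : ℝ) * 3.15 ^ 2 < 13 ^ 2 := by norm_num
  have hkey : 16 * Real.pi ^ 2 < L ^ 2 := by linarith
  have hθ2 : θ ^ 2 = 4 * Real.pi ^ 2 / L ^ 2 := by
    rw [hθ, div_pow]; ring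
  have h3 : (θ ^ 2) ^ 2 < Real.pi ^ 2 / L ^ 2 := by
    rw [hθ2, div_pow, div_lt_div_iff₀ (by positivity) (by positivity)]
    have hπL : 0 < Real.pi ^ 2 * L ^ 2 := by positivity
    nlinarith
  exact lt_of_le_of_lt h2 h3

/-- **THE PARENTHETICAL «γ₀ = π²/L²» FAILS for every L ≥ 13**: on every torus `T = Π_μ ℤ/(L·M_μ)` (`d + 1 ≥ 1` directions,
`L = k + 1`) there is `ω ≠ 0` with `Q′₁ω = 0` and `‖Δ₀ω‖² < (π²/L²)‖ω‖²`. [cite: Balaban1984PropagatorsII, p.242 «‖Δ₀ω‖² ≥ γ₀‖ω‖² with γ₀ > 0 (we can take γ₀ = π²/L² in fact)»; refuted as printed] -/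
theorem poincare_pi_sq_fails (hk : 12 ≤ k) :
    ∃ ω : Tor (fine (k + 1) M) → ℂ, ω ≠ 0 ∧ QsOp (k + 1) M *ᵥ ω = 0 ∧
      (star (LapS (fine (k + 1) M) 1 *ᵥ ω) ⬝ᵥ (LapS (fine (k + 1) M) 1 *ᵥ ω)).re
        < Real.pi ^ 2 / ((k : ℝ) + 1) ^ 2 * (star ω ⬝ᵥ ω).re := by
  have hk1 : 1 ≤ k := le_trans (by norm_num) hk
  refine ⟨omega0 k M hk1, omega0_ne_zero k M hk1, QsOp_omega0 k M hk1, ?_⟩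
  rw [normSq_LapS_omega0]
  have hpos : 0 < (star (omega0 k M hk1) ⬝ᵥ omega0 k M hk1).re := by
    rw [normSq_omega0, Complex.natCast_re]
    exact_mod_cast Fintype.card_pos
  exact mul_lt_mul_of_pos_right (witness_ratio_lt k hk) hpos

/-- the same as a negation of the printed parenthetical claim. [cite: Balaban1984PropagatorsII, p.242 «(we can take γ₀ = π²/L² in fact)»; refuted as printed] -/
theorem not_poincare_pi_sq (hk : 12 ≤ k) :
    ¬ ∀ ω : Tor (fine (k + 1) M) → ℂ, QsOp (k + 1) M *ᵥ ω = 0 →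
      Real.pi ^ 2 / ((k : ℝ) + 1) ^ 2 * (star ω ⬝ᵥ ω).re
        ≤ (star (LapS (fine (k + 1) M) 1 *ᵥ ω) ⬝ᵥ (LapS (fine (k + 1) M) 1 *ᵥ ω)).re := by
  intro H
  obtain ⟨ω, _, hQ, hlt⟩ := poincare_pi_sq_fails k M hk
  exact absurd (H ω hQ) (not_le.mpr hlt)

/-- **THE ORDER OF THE TRUE CONSTANT**: any `γ₀` with `‖Δ₀ω‖² ≥ γ₀‖ω‖²` on `Q′₁ω = 0` (any L ≥ 2) satisfies
`γ₀ ≤ (2 − 2cos(2π/L))²` (`≤ 16π⁴/L⁴`) — order L⁻⁴, the order certified in `…B6DeltaPrime2110Torus` (`(8/L²)²`), not L⁻².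
[cite: Balaban1984PropagatorsII, p.242 «‖Δ₀ω‖² ≥ γ₀‖ω‖² with γ₀ > 0»] [folklore] -/
theorem gamma0_le_of_poincare (hk : 1 ≤ k) {γ₀ : ℝ}
    (H : ∀ ω : Tor (fine (k + 1) M) → ℂ, QsOp (k + 1) M *ᵥ ω = 0 →
      γ₀ * (star ω ⬝ᵥ ω).re ≤ (star (LapS (fine (k + 1) M) 1 *ᵥ ω) ⬝ᵥ (LapS (fine (k + 1) M) 1 *ᵥ ω)).re) :
    γ₀ ≤ (2 - 2 * Real.cos (2 * Real.pi / ((k : ℝ) + 1))) ^ 2 := by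
  have h := H (omega0 k M hk) (QsOp_omega0 k M hk)
  rw [normSq_LapS_omega0] at h
  have hpos : 0 < (star (omega0 k M hk) ⬝ᵥ omega0 k M hk).re := by
    rw [normSq_omega0, Complex.natCast_re]
    exact_mod_cast Fintype.card_pos
  exact le_of_mul_le_mul_right h hpos

end

end Literature.MathematicalPhysics.QuantumFieldTheory.Balaban1983to89.B6Eq2110Gamma0Witness
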